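import Mathlib
import HarnessLib
import Summits.HubbardSuperconductivity.HubbardSuperconductivity.Theorems.ChiralWindowCwKLChiralWindowNodeBoundR
import Summits.HubbardSuperconductivity.HubbardSuperconductivity.Theorems.ChiralWindowCwKLChiralWindowBlockNode
import Summits.HubbardSuperconductivity.HubbardSuperconductivity.Theorems.ChiralWindowCwKLChiralWindowCertTrig
import Summits.HubbardSuperconductivity.HubbardSuperconductivity.Theorems.ChiralWindowDefsResidual

/-!
# Crux `CwKLChiralWindow` (stmt-1741), line `Sketch`: block-level node data, residual form (F4b-R)

`stub_klBlockNodeR`: the residual-form variant of `…BlockNode` (`stub_klBlockNode`), i.e. the block-level form of the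
pointwise amplitude bounds of `…NodeBoundR` (`stub_klNodeBoundR`).  For `μ ∈ (-4,0)`, a certificate block `b : KLBlock`
(vocabulary of `Theorems/ChiralWindowDefs.lean`, read in the residual form of `Theorems/ChiralWindowDefsResidual.lean`)
with Temple data accepted by the residual-form checker (`b.templeOKR tab χ = true`) in a channel `χ ≠ A1g` without the
bare-`U` term (`b.withU = false`), the residual-form block enclosures `b.EnclosureR tab μ χ` (the field `Thi` bounds the
RESIDUAL integral `∫ (F - s·Φ)²`, `s = b.s` the shift), a row bound `R2` for `χ₀` and the multiplicity condition
`Hhi < 2ρhi²` (`3ρhi²` on `E`), every bottom state `ψ` of the channel obeys a.e. on the Fermi curve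
`|F_Φ(k)| ≤ √N (|L| |ψ(k)| + √R2 √e)` off `E` and `|F_Φ(k)|, |F_Φ(rot³k)| ≤ √N (|L| √(ψ(k)² + ψ(rot k)²) + √R2 √e)` on `E`,
where `Φ = b.trialFun tab`, `F_Φ = ∫ χ₀ Φ`, `N = ∫ Φ²`, `L = b.lowerR tab χ` (residual Temple bound
`min g(ρlo) g(ρhi)`, `g(ρ) = (βρ - ρ² - ẽ)/(β - ρ)`) and `e = b.katoR = ẽ/(β - ρhi)²` (residual Kato bound), `ẽ = b.etil`.

Proof: instantiate `stub_klNodeBoundR` with the block's data — `withU := b.withU (= false)`, the trial `Φ`, the casts of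
`b.rholo, b.rhohi, b.etil, b.Hhi, b.beta, b.s`, and the deflation family read off `b.defl` (`kl_bkn_deflKernel_eq`) —
discharging its real hypotheses from the Boolean test (`templeOKR`, unpacked by `simp`) and the enclosures
(`kl_bkn_rayleigh`: `ρlo N ≤ Q ≤ ρhi N`, `ρhi < 0`, and its last conclusion read with the residual integral,
`E ≤ (Thi/Nlo) N = ẽ N`), and translating `min (g ρlo) (g ρhi)` to `b.lowerR` and `ẽ/(β - ρhi)²` to `b.katoR` by
`push_cast`.
-/

noncomputable section

set_option linter.dupNamespace false

namespace Summit.HubbardSuperconductivity.HubbardSuperconductivity.Theorems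

open MeasureTheory Literature.MathematicalPhysics.QuantumLattice CwKLChiralWindow

/-- **Block-level node data, residual form (F4b-R).** For `μ ∈ (-4,0)`, a block `b` with residual-form Temple data in a
channel `χ ≠ A1g` without the bare-`U` term, the residual-form block enclosures, a row bound `R2` and the multiplicity
condition `Hhi < 2ρhi²` (`3ρhi²` on `E`): every bottom state `ψ` of the channel obeys, a.e. on the Fermi curve,
`|F_Φ(k)| ≤ √N (|L| |ψ(k)| + √R2 √e)` off `E` and `|F_Φ(k)|, |F_Φ(rot³k)| ≤ √N (|L| √(ψ(k)² + ψ(rot k)²) + √R2 √e)` on `E`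
(`Φ` the block's trial, `F_Φ = ∫ χ₀ Φ`, `N = ∫Φ²`, `L = b.lowerR`, `e = b.katoR`). [folklore] -/
theorem stub_klBlockNodeR : ∀ μ ∈ Set.Ioo (-4 : ℝ) 0, ∀ (b : KLBlock) (tab : List KLTrig) (χ : D4Irrep) (R2 : ℝ),
    b.templeOKR tab χ = true → b.withU = false → χ ≠ D4Irrep.A1g → b.EnclosureR tab μ χ → 0 ≤ R2 →
    (∀ᵐ k ∂fermiCurveMeasure (squareDispersion 1 0) μ,
      ∫ k', lindhardFunction (squareDispersion 1 0) μ (k + k') ^ 2 ∂fermiCurveMeasure (squareDispersion 1 0) μ ≤ R2) →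
    (b.Hhi : ℝ) < (if χ = D4Irrep.E then 3 else 2) * (b.rhohi : ℝ) ^ 2 →
    ∀ ψ : Momentum → ℝ, IsChannelState (squareDispersion 1 0) μ χ ψ →
      pairingForm (squareDispersion 1 0) μ 1 ψ = channelInf (squareDispersion 1 0) μ 1 χ →
      (χ ≠ D4Irrep.E → ∀ᵐ k ∂fermiCurveMeasure (squareDispersion 1 0) μ,
        |∫ k', lindhardFunction (squareDispersion 1 0) μ (k + k') * b.trialFun tab k'
            ∂fermiCurveMeasure (squareDispersion 1 0) μ| ≤
          Real.sqrt (∫ k, b.trialFun tab k ^ 2 ∂fermiCurveMeasure (squareDispersion 1 0) μ) *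
            (|((b.lowerR tab χ : ℚ) : ℝ)| * |ψ k| + Real.sqrt R2 * Real.sqrt ((b.katoR : ℚ) : ℝ))) ∧
      (χ = D4Irrep.E → ∀ᵐ k ∂fermiCurveMeasure (squareDispersion 1 0) μ,
        |∫ k', lindhardFunction (squareDispersion 1 0) μ (k + k') * b.trialFun tab k'
            ∂fermiCurveMeasure (squareDispersion 1 0) μ| ≤
          Real.sqrt (∫ k, b.trialFun tab k ^ 2 ∂fermiCurveMeasure (squareDispersion 1 0) μ) *
            (|((b.lowerR tab χ : ℚ) : ℝ)| * Real.sqrt (ψ k ^ 2 + ψ (rotMomentum k) ^ 2) +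
              Real.sqrt R2 * Real.sqrt ((b.katoR : ℚ) : ℝ)) ∧
        |∫ k', lindhardFunction (squareDispersion 1 0) μ (rotMomentum (rotMomentum (rotMomentum k)) + k') *
            b.trialFun tab k' ∂fermiCurveMeasure (squareDispersion 1 0) μ| ≤
          Real.sqrt (∫ k, b.trialFun tab k ^ 2 ∂fermiCurveMeasure (squareDispersion 1 0) μ) *
            (|((b.lowerR tab χ : ℚ) : ℝ)| * Real.sqrt (ψ k ^ 2 + ψ (rotMomentum k) ^ 2) +
              Real.sqrt R2 * Real.sqrt ((b.katoR : ℚ) : ℝ))) := by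
  intro μ hμ b tab χ R2 hT hWU hχA hE hR2 hR hmul ψ hψs hbot
  -- the Boolean test, unpacked
  have hT' := hT
  simp only [KLBlock.templeOKR, KLBlock.ritzOK, KLBlock.deflOK, Bool.and_eq_true, decide_eq_true_eq,
    List.all_eq_true, Bool.or_eq_true, Bool.not_eq_true'] at hT'
  obtain ⟨⟨⟨⟨⟨⟨⟨⟨⟨⟨⟨⟨huse, -⟩, hfits⟩, hNlo⟩, -⟩, -⟩, hQhi⟩, -⟩, hdefl⟩, hThi⟩, hβ0⟩, hHβ⟩, hρβ⟩ := hT'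
  -- the enclosures, unpacked
  obtain ⟨h1, hH⟩ := hE
  obtain ⟨hN1, hN2, hQ1, hQ2, hEE⟩ := h1 huse
  unfold KLBlock.baseKernel at hQ1 hQ2 hEE
  simp only [KLBlock.sectorKernel, KLBlock.baseKernel, kl_bkn_deflKernel_eq] at hH
  -- the real hypotheses of `stub_klNodeBoundR` (the Rayleigh bookkeeping is that of `kl_bkn_rayleigh`, its last
  -- conclusion read with the residual integral `E ≤ Thi` in place of the image norm: `E ≤ (Thi/Nlo) N = etil N`)
  obtain ⟨hN, hρlo, hρhi, hρhi0, het⟩ := kl_bkn_rayleigh (by exact_mod_cast hNlo) hN1 hN2 hQ1 hQ2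
    (by exact_mod_cast hQhi) hEE (by exact_mod_cast hThi)
  have hρlo_eq : ((b.rholo : ℚ) : ℝ) = min ((b.Qlo : ℝ) / b.Nlo) ((b.Qlo : ℝ) / b.Nhi) := by
    rw [KLBlock.rholo]; push_cast; rfl
  have hρhi_eq : ((b.rhohi : ℚ) : ℝ) = max ((b.Qhi : ℝ) / b.Nlo) ((b.Qhi : ℝ) / b.Nhi) := by
    rw [KLBlock.rhohi]; push_cast; rfl
  have het_eq : ((b.etil : ℚ) : ℝ) = (b.Thi : ℝ) / b.Nlo := by
    rw [KLBlock.etil]; push_cast; rfl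
  rw [← hρlo_eq] at hρlo
  rw [← hρhi_eq] at hρhi hρhi0
  rw [← het_eq] at het
  have hd : ((KLBlock.dmult χ : ℚ) : ℝ) = if χ = D4Irrep.E then 2 else 1 := by
    unfold KLBlock.dmult; split_ifs <;> norm_num
  have hHβ' : (b.Hhi : ℝ) - (if χ = D4Irrep.E then 2 else 1) * (b.rhohi : ℝ) ^ 2 ≤ (b.beta : ℝ) ^ 2 := by
    rw [← hd]; exact_mod_cast hHβ
  have hR' : ∀ᵐ k ∂fermiCurveMeasure (squareDispersion 1 0) μ, ∫ k', ((if b.withU then 1 else 0) +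
      lindhardFunction (squareDispersion 1 0) μ (k + k')) ^ 2 ∂fermiCurveMeasure (squareDispersion 1 0) μ ≤ R2 := by
    simpa only [hWU, Bool.false_eq_true, ↓reduceIte, zero_add] using hR
  -- the translations of `lowerR` and `katoR`
  have hlower : ((b.lowerR tab χ : ℚ) : ℝ) =
      min (((b.beta : ℝ) * b.rholo - b.rholo ^ 2 - b.etil) / (b.beta - b.rholo))
        (((b.beta : ℝ) * b.rhohi - b.rhohi ^ 2 - b.etil) / (b.beta - b.rhohi)) := by
    rw [KLBlock.lowerR, if_pos (by rw [huse, hT, Bool.true_and])]; simp only [KLBlock.templeR]; push_cast; rfl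
  have hkato : ((b.katoR : ℚ) : ℝ) = (b.etil : ℝ) / (b.beta - b.rhohi) ^ 2 := by
    rw [KLBlock.katoR]; push_cast; rfl
  -- the abstract node bound, instantiated with the block's data
  have hnb := stub_klNodeBoundR μ hμ χ b.withU b.defl.length (fun m => ((b.defl[m.1]).1 : ℝ))
    (fun m => (klTab tab (b.defl[m.1]).2).toFun) (b.trialFun tab) b.rholo b.rhohi b.etil b.Hhi b.beta b.s R2
    (fun h => absurd (hWU.symm.trans h) Bool.false_ne_true)
    (fun m => Rat.cast_nonneg.2 (hdefl _ (List.getElem_mem m.2)).1.1)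
    (fun m => kl_tr_toFun_memLp _ hμ) (kl_tr_toFun_memLp _ hμ) (stub_klTrigChannel _ χ hfits) hN hρlo hρhi hρhi0
    het hH (by exact_mod_cast hβ0) hHβ' (by exact_mod_cast hρβ) (Or.inr hχA) hR2 hR' hmul ψ hψs hbot
  rw [hlower, hkato]
  simp only [hWU, Bool.false_eq_true, ↓reduceIte, zero_add] at hnb
  exact hnb

end Summit.HubbardSuperconductivity.HubbardSuperconductivity.Theorems

end
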